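import Mathlib
import Summits.Ventures.PercRepro2.Defs
import Summits.Ventures.PercRepro2.Graph
import Summits.Ventures.PercRepro2.Harris
import Summits.Ventures.PercRepro2.PendantRoot
import Summits.Ventures.PercRepro2.RowC1PendZ

/-!
# Leaf marks reduce (blind cell PercRepro2, p2 g35; proofs/P2-G35-PENDZ.md §12)

For the pendant-root quantity `zpp` of `RowC1PendZ`, a mark that is a LEAF hands its role to its
neighbour: if `b` is a leaf at `w` through the edge `f` then `zpp(b) = p f · zpp(w)`
(`zpp_leaf_b`), and likewise for `o` (`zpp_leaf_o`).  So for `(Z″)` the marks may be assumed to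
have degree `≥ 2` (`zpp_nonneg_of_leaf_b`, `zpp_nonneg_of_leaf_o`).  Uses the cell's
`PendantRoot.connEvent_other_leaf` / `free_connEvent` / `prob_inter_openEdge_of_free`.  Std axioms.
-/

namespace Summit.Ventures.PercRepro2

namespace RowC1

section Leaf

variable {V : Type*} {E : Type*} [Fintype E] [DecidableEq E]
  {R : Type*} [Field R] [LinearOrder R] [IsStrictOrderedRing R]

omit [LinearOrder R] [IsStrictOrderedRing R] in
/-- **A leaf mark `b` reduces to its neighbour**: `zpp(… b) = p f · zpp(… w)` when `b`'s only edge
is `f = bw`. -/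
theorem zpp_leaf_b (p : E → R) (ends : E → Sym2 V) (v a₂ o b w : V) (f : E)
    (hf : ends f = s(b, w)) (hleaf : ∀ e, b ∈ ends e → e = f) (hbw : b ≠ w) (hba : b ≠ a₂)
    (hbo : b ≠ o) (hbv : b ≠ v) :
    zpp p ends v a₂ o b = p f * zpp p ends v a₂ o w := by
  have hB : connEvent ends a₂ b = openEdge f ∩ connEvent ends a₂ w :=
    PendantRoot.connEvent_other_leaf hf hleaf hbw hba
  have hfreeO : PendantRoot.Free f (connEvent ends a₂ o) :=
    PendantRoot.free_connEvent hf hleaf hbw hba.symm hbo.symm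
  have hfreeF : PendantRoot.Free f (connEvent ends a₂ v) :=
    PendantRoot.free_connEvent hf hleaf hbw hba.symm hbv.symm
  have hfreeW : PendantRoot.Free f (connEvent ends a₂ w) :=
    PendantRoot.free_connEvent hf hleaf hbw hba.symm hbw.symm
  have h1 : prob p (connEvent ends a₂ b) = prob p (connEvent ends a₂ w) * p f := by
    rw [hB, Set.inter_comm, PendantRoot.prob_inter_openEdge_of_free p hfreeW]
  have h2 : prob p (connEvent ends a₂ o ∩ connEvent ends a₂ b) =
      prob p (connEvent ends a₂ o ∩ connEvent ends a₂ w) * p f := by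
    rw [hB, show connEvent ends a₂ o ∩ (openEdge f ∩ connEvent ends a₂ w) =
        (connEvent ends a₂ o ∩ connEvent ends a₂ w) ∩ openEdge f by
      ext ω; simp only [Set.mem_inter_iff]; tauto]
    exact PendantRoot.prob_inter_openEdge_of_free p (hfreeO.inter hfreeW)
  have h3 : prob p (connEvent ends a₂ b ∩ connEvent ends a₂ v) =
      prob p (connEvent ends a₂ w ∩ connEvent ends a₂ v) * p f := by
    rw [hB, show openEdge f ∩ connEvent ends a₂ w ∩ connEvent ends a₂ v =
        (connEvent ends a₂ w ∩ connEvent ends a₂ v) ∩ openEdge f by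
      ext ω; simp only [Set.mem_inter_iff]; tauto]
    exact PendantRoot.prob_inter_openEdge_of_free p (hfreeW.inter hfreeF)
  unfold zpp
  rw [h1, h2, h3]
  ring

omit [LinearOrder R] [IsStrictOrderedRing R] in
/-- **A leaf mark `o` reduces to its neighbour**: `zpp(… o …) = p f · zpp(… w …)` when `o`'s only
edge is `f = ow`. -/
theorem zpp_leaf_o (p : E → R) (ends : E → Sym2 V) (v a₂ o b w : V) (f : E)
    (hf : ends f = s(o, w)) (hleaf : ∀ e, o ∈ ends e → e = f) (how : o ≠ w) (hoa : o ≠ a₂)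
    (hob : o ≠ b) (hov : o ≠ v) :
    zpp p ends v a₂ o b = p f * zpp p ends v a₂ w b := by
  have hO : connEvent ends a₂ o = openEdge f ∩ connEvent ends a₂ w :=
    PendantRoot.connEvent_other_leaf hf hleaf how hoa
  have hWo : connEvent ends v o = openEdge f ∩ connEvent ends v w :=
    PendantRoot.connEvent_other_leaf hf hleaf how hov
  have hfreeB : PendantRoot.Free f (connEvent ends a₂ b) :=
    PendantRoot.free_connEvent hf hleaf how hoa.symm hob.symm
  have hfreeF : PendantRoot.Free f (connEvent ends a₂ v) :=
    PendantRoot.free_connEvent hf hleaf how hoa.symm hov.symm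
  have hfreeW : PendantRoot.Free f (connEvent ends a₂ w) :=
    PendantRoot.free_connEvent hf hleaf how hoa.symm how.symm
  have hfreeVW : PendantRoot.Free f (connEvent ends v w) :=
    PendantRoot.free_connEvent hf hleaf how hov.symm how.symm
  have h1 : prob p (connEvent ends a₂ o) = prob p (connEvent ends a₂ w) * p f := by
    rw [hO, Set.inter_comm, PendantRoot.prob_inter_openEdge_of_free p hfreeW]
  have h2 : prob p (connEvent ends a₂ o ∩ connEvent ends a₂ b) =
      prob p (connEvent ends a₂ w ∩ connEvent ends a₂ b) * p f := by
    rw [hO, show openEdge f ∩ connEvent ends a₂ w ∩ connEvent ends a₂ b =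
        (connEvent ends a₂ w ∩ connEvent ends a₂ b) ∩ openEdge f by
      ext ω; simp only [Set.mem_inter_iff]; tauto]
    exact PendantRoot.prob_inter_openEdge_of_free p (hfreeW.inter hfreeB)
  have h3 : prob p (connEvent ends a₂ o ∩ connEvent ends a₂ v) =
      prob p (connEvent ends a₂ w ∩ connEvent ends a₂ v) * p f := by
    rw [hO, show openEdge f ∩ connEvent ends a₂ w ∩ connEvent ends a₂ v =
        (connEvent ends a₂ w ∩ connEvent ends a₂ v) ∩ openEdge f by
      ext ω; simp only [Set.mem_inter_iff]; tauto]
    exact PendantRoot.prob_inter_openEdge_of_free p (hfreeW.inter hfreeF)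
  have h4 : prob p ((connEvent ends a₂ v)ᶜ ∩ connEvent ends v o) =
      prob p ((connEvent ends a₂ v)ᶜ ∩ connEvent ends v w) * p f := by
    rw [hWo, show (connEvent ends a₂ v)ᶜ ∩ (openEdge f ∩ connEvent ends v w) =
        ((connEvent ends a₂ v)ᶜ ∩ connEvent ends v w) ∩ openEdge f by
      ext ω; simp only [Set.mem_inter_iff]; tauto]
    exact PendantRoot.prob_inter_openEdge_of_free p (hfreeF.compl.inter hfreeVW)
  unfold zpp
  rw [h1, h2, h3, h4]
  ring

/-- `(Z″)` for a leaf mark `b` follows from `(Z″)` for its neighbour. -/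
theorem zpp_nonneg_of_leaf_b (p : E → R) (hp : IsProbVec p) (ends : E → Sym2 V)
    (v a₂ o b w : V) (f : E) (hf : ends f = s(b, w)) (hleaf : ∀ e, b ∈ ends e → e = f)
    (hbw : b ≠ w) (hba : b ≠ a₂) (hbo : b ≠ o) (hbv : b ≠ v) (h : 0 ≤ zpp p ends v a₂ o w) :
    0 ≤ zpp p ends v a₂ o b := by
  rw [zpp_leaf_b p ends v a₂ o b w f hf hleaf hbw hba hbo hbv]
  exact mul_nonneg (hp.nonneg f) h

/-- `(Z″)` for a leaf mark `o` follows from `(Z″)` for its neighbour. -/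
theorem zpp_nonneg_of_leaf_o (p : E → R) (hp : IsProbVec p) (ends : E → Sym2 V)
    (v a₂ o b w : V) (f : E) (hf : ends f = s(o, w)) (hleaf : ∀ e, o ∈ ends e → e = f)
    (how : o ≠ w) (hoa : o ≠ a₂) (hob : o ≠ b) (hov : o ≠ v) (h : 0 ≤ zpp p ends v a₂ w b) :
    0 ≤ zpp p ends v a₂ o b := by
  rw [zpp_leaf_o p ends v a₂ o b w f hf hleaf how hoa hob hov]
  exact mul_nonneg (hp.nonneg f) h

end Leaf

end RowC1

end Summit.Ventures.PercRepro2

/-! ## The `o`-pendant-at-`v` equality family (p2 g35; P2-G34-ROOT §2): `zpp` vanishes identically when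
`o = v`, hence when `o` is a leaf at `v`. -/

namespace Summit.Ventures.PercRepro2

namespace RowC1

section LeafEquality

variable {V : Type*} {E : Type*} [Fintype E] [DecidableEq E]
  {R : Type*} [Field R] [LinearOrder R] [IsStrictOrderedRing R]

omit [LinearOrder R] [IsStrictOrderedRing R] in
/-- `zpp` with `o = v` is identically zero. -/
theorem zpp_o_eq_v (p : E → R) (ends : E → Sym2 V) (v a₂ b : V) : zpp p ends v a₂ v b = 0 := by
  have hvv : connEvent ends v v = Set.univ := by
    ext ω
    simp only [mem_connEvent, Set.mem_univ, iff_true]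
    exact conn_refl _ _ _
  unfold zpp
  rw [hvv, Set.inter_univ, Set.inter_self, prob_compl,
    Set.inter_comm (connEvent ends a₂ v) (connEvent ends a₂ b)]
  ring

omit [LinearOrder R] [IsStrictOrderedRing R] in
/-- **The equality family**: if `o` is a leaf at `v` then `zpp = 0`. -/
theorem zpp_eq_zero_of_leaf_o_at_v (p : E → R) (ends : E → Sym2 V) (v a₂ o b : V) (f : E)
    (hf : ends f = s(o, v)) (hleaf : ∀ e, o ∈ ends e → e = f) (hov : o ≠ v) (hoa : o ≠ a₂)
    (hob : o ≠ b) : zpp p ends v a₂ o b = 0 := by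
  rw [zpp_leaf_o p ends v a₂ o b v f hf hleaf hov hoa hob hov, zpp_o_eq_v, mul_zero]

end LeafEquality

end RowC1

end Summit.Ventures.PercRepro2
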